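import Summits.Ventures.Crystal3D.Theorems.StickyWulffConstantTextureBuildHealClusters
import HarnessLib

/-!
# TB-1 brick L-HEAL, selection: WHICH defects a grain heals — the defect clusters that do not chain out of the grain's zone
# (lane T, crux `TextureLiminfV5`, stmt-Ventures-23912; blueprint HOME/wulff-p2/g23/TB-COVER-BLUEPRINT-g23.md step S3 «selection», cf-p1 (ccxciv)(2)
# «sparse-defect detection + collar selection»)

HONEST FRAMING. Venture `Summits/Ventures/Crystal3D` (cell `crystal3d-full`), route `route-Ventures-StickyWulffConstant`, helper `--supports` the
law-v5 crux `TextureLiminfV5` (stmt-Ventures-23912).  Pure finite combinatorics over '…TextureBuildHealClusters' (census-free, standard axioms).  Nothing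
about any cover or texture is claimed; F-C1 not moved.

WHY.  `exists_healed_clusters` ('…HealClusters') heals any family of bounded cluster sets `P f` that are CLOSED at range `2` (every defect of grain `f`
within `2` of `P f` lies in `P f`) and more than `4` apart across grains.  This file says which sets the constructor takes and proves they qualify:

* `IsDefect x S p` — the DEFECTS of the packing `x` relative to the grain lattice `S`: off-lattice balls, lattice balls with a vacant `S`-neighbour,
  vacant `S`-sites;
* `defectLink x S W` — two defects inside the window `W` at distance `≤ 2`; chains = `Relation.ReflTransGen`;
* **`healable x S W Z`** — the defects in `W` all of whose link-chains stay inside the zone `Z` (the defect clusters of `Z` that do not reach out of `Z`);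
* `mem_healable_of_isDefect_of_near` — if the `2`-collar of `Z` lies in `W`, `healable` IS CLOSED at range `2`, whence the three closure hypotheses
  `hc1/hc2/hc3` of `exists_healed_clusters` (`healable_closed_ball`, `healable_closed_neighbours`, `healable_closed_site`);
* `exists_escape_of_not_mem_healable` — a defect of `W` that is NOT healed has a link-chain to a defect of `W ∖ Z` (it belongs to the rough boundary);
* **`exists_healed_zones`** — for a finite family of grains `(S_f, W_f, Z_f)` with bounded windows, `2`-collars `{dist(·, Z_f) ≤ 2} ⊆ W_f` and zones more
  than `4` apart: ONE healed unit packing `x'` with `6N' − b(x') ≤ 6N − b(x)`, `range x'` described exactly, complete and clean within `2` of every healed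
  cluster, `N ≤ N' + #{balls within 1 of a healed cluster of some grain and off that grain's lattice}`, and the LEFTOVER law: every vacant `S_f`-site / every
  off-lattice ball of `x'` within `1` of `Z_f` was already a defect of `x` and chains (through defects of `x` in `W_f`, steps `≤ 2`) out of `Z_f`.
So after healing, the only defects a grain keeps near its zone are those connected to the zone's boundary (walls, free surface): roughness, priced per
unit AREA by the good-scale step (census §F3), never summable point junk (§F1).
-/

noncomputable section

namespace Summit.Ventures.Crystal3D.Theorems

open Finset Summit.Ventures.Crystal3D
open Literature.MathematicalPhysics.StatisticalMechanics (IsHaggSeq contactDeficiency)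
open Summit.Ventures.Crystal3D.Cruxes.TextureLiminf.TexShadow (E3 stacking)

section Defects

variable {N : ℕ}

/-- The DEFECTS of the labelled configuration `x` relative to the lattice (site set) `S`: a ball off `S`, a ball on `S` with a vacant `S`-neighbour
(an `S`-site at distance `1` that is not a ball), or a vacant `S`-site. -/
def IsDefect (x : Fin N → E3) (S : Set E3) (p : E3) : Prop :=
  (p ∈ Set.range x ∧ ¬ (p ∈ S ∧ ∀ w ∈ S, dist p w = 1 → w ∈ Set.range x)) ∨ (p ∈ S ∧ p ∉ Set.range x)

/-- The LINK relation of the defect graph inside the window `W`: two defects of `W` at distance `≤ 2`. -/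
def defectLink (x : Fin N → E3) (S W : Set E3) (p q : E3) : Prop :=
  IsDefect x S p ∧ p ∈ W ∧ IsDefect x S q ∧ q ∈ W ∧ dist p q ≤ 2

/-- The HEALABLE cluster set of the zone `Z` (inside the window `W`): the defects of `W` every link-chain from which stays inside `Z` — the union of the
defect clusters (components of the link graph of `W`) contained in `Z`. -/
def healable (x : Fin N → E3) (S W Z : Set E3) : Set E3 :=
  {p | IsDefect x S p ∧ p ∈ W ∧ ∀ q, Relation.ReflTransGen (defectLink x S W) p q → q ∈ Z}

variable {x : Fin N → E3} {S W Z : Set E3}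

/-- An off-lattice ball is a defect. -/
theorem isDefect_of_not_mem_lattice {i : Fin N} (h : x i ∉ S) : IsDefect x S (x i) :=
  Or.inl ⟨⟨i, rfl⟩, fun h' => h h'.1⟩

/-- A ball with a vacant `S`-neighbour is a defect. -/
theorem isDefect_of_vacant_neighbour {i : Fin N} {w : E3} (hw : w ∈ S) (hd : dist (x i) w = 1) (hvac : w ∉ Set.range x) :
    IsDefect x S (x i) :=
  Or.inl ⟨⟨i, rfl⟩, fun h' => hvac (h'.2 w hw hd)⟩

/-- A vacant `S`-site is a defect. -/
theorem isDefect_of_vacant_site {w : E3} (hw : w ∈ S) (hvac : w ∉ Set.range x) : IsDefect x S w :=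
  Or.inr ⟨hw, hvac⟩

/-- A healable point is a defect of the window lying in the zone. -/
theorem mem_healable_iff {p : E3} : p ∈ healable x S W Z ↔
    IsDefect x S p ∧ p ∈ W ∧ ∀ q, Relation.ReflTransGen (defectLink x S W) p q → q ∈ Z := Iff.rfl

/-- The healable set lies in the zone. -/
theorem healable_subset_zone : healable x S W Z ⊆ Z := fun _ hp => hp.2.2 _ Relation.ReflTransGen.refl

/-- The healable set lies in the window. -/
theorem healable_subset_window : healable x S W Z ⊆ W := fun _ hp => hp.2.1

/-- The healable set of a bounded window is bounded. -/
theorem isBounded_healable (hW : Bornology.IsBounded W) : Bornology.IsBounded (healable x S W Z) :=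
  hW.subset healable_subset_window

/-- **CLOSURE**: if the `2`-collar of the zone lies in the window, a defect within `2` of a healable point is healable. -/
theorem mem_healable_of_isDefect_of_near (hZW : ∀ y, (∃ z ∈ Z, dist y z ≤ 2) → y ∈ W) {p : E3} (hp : IsDefect x S p)
    (hnear : ∃ q ∈ healable x S W Z, dist p q ≤ 2) : p ∈ healable x S W Z := by
  obtain ⟨q, hq, hpq⟩ := hnear
  have hqZ : q ∈ Z := healable_subset_zone hq
  have hpW : p ∈ W := hZW p ⟨q, hqZ, hpq⟩
  have hlink : defectLink x S W q p := ⟨hq.1, hq.2.1, hp, hpW, by rw [dist_comm]; exact hpq⟩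
  exact ⟨hp, hpW, fun q' hchain => hq.2.2 q' (Relation.ReflTransGen.head hlink hchain)⟩

/-- Closure, form `hc1` of `exists_healed_clusters`: a ball within `2` of the healable set and not in it lies on the lattice. -/
theorem healable_closed_ball (hZW : ∀ y, (∃ z ∈ Z, dist y z ≤ 2) → y ∈ W) (i : Fin N)
    (hnear : ∃ q ∈ healable x S W Z, dist (x i) q ≤ 2) (hnot : x i ∉ healable x S W Z) : x i ∈ S := by
  by_contra h
  exact hnot (mem_healable_of_isDefect_of_near hZW (isDefect_of_not_mem_lattice h) hnear)

/-- Closure, form `hc2`: a ball within `2` of the healable set and not in it has all its `S`-neighbours occupied. -/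
theorem healable_closed_neighbours (hZW : ∀ y, (∃ z ∈ Z, dist y z ≤ 2) → y ∈ W) (i : Fin N)
    (hnear : ∃ q ∈ healable x S W Z, dist (x i) q ≤ 2) (hnot : x i ∉ healable x S W Z) :
    ∀ w ∈ S, dist (x i) w = 1 → w ∈ Set.range x := by
  intro w hw hd
  by_contra hvac
  exact hnot (mem_healable_of_isDefect_of_near hZW (isDefect_of_vacant_neighbour hw hd hvac) hnear)

/-- Closure, form `hc3`: an `S`-site within `2` of the healable set and not in it is occupied. -/
theorem healable_closed_site (hZW : ∀ y, (∃ z ∈ Z, dist y z ≤ 2) → y ∈ W) {w : E3} (hw : w ∈ S)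
    (hnear : ∃ q ∈ healable x S W Z, dist w q ≤ 2) (hnot : w ∉ healable x S W Z) : w ∈ Set.range x := by
  by_contra hvac
  exact hnot (mem_healable_of_isDefect_of_near hZW (isDefect_of_vacant_site hw hvac) hnear)

/-- **LEFTOVERS ESCAPE**: a defect of the window that is not healable has a link-chain to a point outside the zone. -/
theorem exists_escape_of_not_mem_healable {p : E3} (hp : IsDefect x S p) (hpW : p ∈ W) (hnot : p ∉ healable x S W Z) :
    ∃ q, Relation.ReflTransGen (defectLink x S W) p q ∧ q ∉ Z := by
  by_contra h
  push Not at h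
  exact hnot ⟨hp, hpW, h⟩

/-- Every point reached by a link-chain from a defect of the window is a defect of the window. -/
theorem isDefect_of_reflTransGen {p q : E3} (hp : IsDefect x S p ∧ p ∈ W) (h : Relation.ReflTransGen (defectLink x S W) p q) :
    IsDefect x S q ∧ q ∈ W := by
  induction h with
  | refl => exact hp
  | tail _ hlink _ => exact ⟨hlink.2.2.1, hlink.2.2.2.1⟩

/-- A healable point is at distance `0` from the healable set (trivial witness form used below). -/
theorem exists_near_of_mem_healable {p : E3} (hp : p ∈ healable x S W Z) (r : ℝ) (hr : 0 ≤ r) :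
    ∃ q ∈ healable x S W Z, dist p q ≤ r :=
  ⟨p, hp, by rw [dist_self]; exact hr⟩

end Defects

/-! ## Healing the healable clusters of a family of zones -/

section Zones

variable {N : ℕ} {x : Fin N → E3} {ι : Type*} [Fintype ι]
  {L : ι → (E3 ≃ₗᵢ[ℝ] E3)} {s : ι → E3} {σ : ι → ℤ → ℤ} {W Z : ι → Set E3}

open scoped Classical in
/-- **HEALING THE ZONES OF A FAMILY OF GRAINS.**  See the module docstring. -/
theorem exists_healed_zones (hx : IsUnitPacking x) (hσ : ∀ f, IsHaggSeq (σ f))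
    (hWbdd : ∀ f, Bornology.IsBounded (W f))
    (hZW : ∀ f y, (∃ z ∈ Z f, dist y z ≤ 2) → y ∈ W f)
    (hZsep : ∀ f g, f ≠ g → ∀ z ∈ Z f, ∀ z' ∈ Z g, 4 < dist z z') :
    ∃ (N' : ℕ) (x' : Fin N' → E3), IsUnitPacking x' ∧
      6 * (N' : ℝ) - (numContacts x' : ℝ) ≤ 6 * (N : ℝ) - (numContacts x : ℝ) ∧
      (∀ y, y ∈ Set.range x' ↔
        (y ∈ Set.range x ∧ ∀ f, ∀ p ∈ healable x (stacking (L f) (s f) (σ f)) (W f) (Z f), 1 < dist y p) ∨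
        (∃ f, y ∈ stacking (L f) (s f) (σ f) ∧ ∃ p ∈ healable x (stacking (L f) (s f) (σ f)) (W f) (Z f), dist y p ≤ 1)) ∧
      (∀ f, ∀ w ∈ stacking (L f) (s f) (σ f),
        (∃ p ∈ healable x (stacking (L f) (s f) (σ f)) (W f) (Z f), dist w p ≤ 2) → w ∈ Set.range x') ∧
      (∀ f j, (∃ p ∈ healable x (stacking (L f) (s f) (σ f)) (W f) (Z f), dist (x' j) p ≤ 2) →
        x' j ∈ stacking (L f) (s f) (σ f)) ∧
      N ≤ N' + (Finset.univ.filter fun i => ∃ f,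
        (∃ p ∈ healable x (stacking (L f) (s f) (σ f)) (W f) (Z f), dist (x i) p ≤ 1) ∧ x i ∉ stacking (L f) (s f) (σ f)).card ∧
      (∀ f, ∀ w ∈ stacking (L f) (s f) (σ f), (∃ z ∈ Z f, dist w z ≤ 1) → w ∉ Set.range x' →
        w ∉ Set.range x ∧ ∃ q, Relation.ReflTransGen (defectLink x (stacking (L f) (s f) (σ f)) (W f)) w q ∧ q ∉ Z f) ∧
      (∀ f j, (∃ z ∈ Z f, dist (x' j) z ≤ 1) → x' j ∉ stacking (L f) (s f) (σ f) →
        x' j ∈ Set.range x ∧ ∃ q, Relation.ReflTransGen (defectLink x (stacking (L f) (s f) (σ f)) (W f)) (x' j) q ∧ q ∉ Z f) := by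
  -- the cluster sets
  let S : ι → Set E3 := fun f => stacking (L f) (s f) (σ f)
  let P : ι → Set E3 := fun f => healable x (S f) (W f) (Z f)
  have hPZ : ∀ f, P f ⊆ Z f := fun f => healable_subset_zone
  have hPbdd : ∀ f, Bornology.IsBounded (P f) := fun f => isBounded_healable (hWbdd f)
  have hsep : ∀ f g, f ≠ g → ∀ p ∈ P f, ∀ q ∈ P g, 4 < dist p q := fun f g hfg p hp q hq =>
    hZsep f g hfg p (hPZ f hp) q (hPZ g hq)
  have hc1 : ∀ f i, (∃ p ∈ P f, dist (x i) p ≤ 2) → x i ∉ P f → x i ∈ S f := fun f i hnear hnot =>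
    healable_closed_ball (hZW f) i hnear hnot
  have hc2 : ∀ f i, (∃ p ∈ P f, dist (x i) p ≤ 2) → x i ∉ P f → ∀ w ∈ S f, dist (x i) w = 1 → w ∈ Set.range x :=
    fun f i hnear hnot => healable_closed_neighbours (hZW f) i hnear hnot
  have hc3 : ∀ f, ∀ w ∈ S f, (∃ p ∈ P f, dist w p ≤ 2) → w ∉ P f → w ∈ Set.range x := fun f w hw hnear hnot =>
    healable_closed_site (hZW f) hw hnear hnot
  obtain ⟨N', x', hx', hdef, hrange, hcomplete, hclean, hcount⟩ := exists_healed_clusters hx hσ hPbdd hsep hc1 hc2 hc3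
  -- a point within `1` of `Z f` is far from the other grains' clusters
  have hfarZ : ∀ f g, f ≠ g → ∀ y, (∃ z ∈ Z f, dist y z ≤ 1) → ∀ p ∈ P g, 1 < dist y p := by
    rintro f g hfg y ⟨z, hz, hyz⟩ p hp
    have h4 := hZsep f g hfg z hz p (hPZ g hp)
    have := dist_triangle z y p
    rw [dist_comm z y] at this
    linarith
  refine ⟨N', x', hx', hdef, hrange, hcomplete, hclean, hcount, ?_, ?_⟩
  · -- leftover vacant sites
    intro f w hw hwZ hvac'
    have hnot := fun h => hvac' ((hrange w).2 h)
    -- `w` is within `1` of no cluster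
    have hfar1 : ∀ g, ∀ p ∈ P g, 1 < dist w p := by
      intro g p hp
      by_cases hgf : g = f
      · subst hgf
        by_contra hle
        push Not at hle
        exact hnot (Or.inr ⟨g, hw, p, hp, hle⟩)
      · exact hfarZ f g (Ne.symm hgf) w hwZ p hp
    have hvac : w ∉ Set.range x := fun h => hnot (Or.inl ⟨h, hfar1⟩)
    -- hence within `2` of no cluster of its own grain (completeness), so not healable, so it escapes
    have hfar2 : ¬ ∃ p ∈ P f, dist w p ≤ 2 := fun h => hvac' (hcomplete f w hw h)
    have hnotP : w ∉ P f := fun h => hfar2 (exists_near_of_mem_healable h 2 (by norm_num))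
    obtain ⟨z, hz, hwz⟩ := hwZ
    exact ⟨hvac, exists_escape_of_not_mem_healable (isDefect_of_vacant_site hw hvac) (hZW f w ⟨z, hz, by linarith⟩) hnotP⟩
  · -- leftover off-lattice balls
    intro f j hjZ hjS
    rcases (hrange (x' j)).1 ⟨j, rfl⟩ with ⟨hjx, hfar1⟩ | ⟨g, hgS, p, hp, hjp⟩
    · have hfar2 : ¬ ∃ p ∈ P f, dist (x' j) p ≤ 2 := fun h => hjS (hclean f j h)
      have hnotP : x' j ∉ P f := fun h => hfar2 (exists_near_of_mem_healable h 2 (by norm_num))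
      obtain ⟨i, hi⟩ := hjx
      obtain ⟨z, hz, hjz⟩ := hjZ
      have hdefect : IsDefect x (S f) (x' j) := by rw [← hi]; exact isDefect_of_not_mem_lattice (by rw [hi]; exact hjS)
      exact ⟨⟨i, hi⟩, exists_escape_of_not_mem_healable hdefect (hZW f _ ⟨z, hz, by linarith⟩) hnotP⟩
    · exfalso
      by_cases hgf : g = f
      · subst hgf; exact hjS hgS
      · exact absurd hjp (not_le.2 (hfarZ f g (Ne.symm hgf) (x' j) hjZ p hp))

end Zones

end Summit.Ventures.Crystal3D.Theorems

end
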